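import Mathlib.Algebra.Polynomial.Eval.Defs
import Mathlib.Algebra.Field.ZMod
import Mathlib.Analysis.SpecialFunctions.Pow.Real
import Mathlib.Analysis.SpecialFunctions.Exp
import Literature.Computability.QuantumComplexity.ShallowCircuitRelations
import Literature.Computability.QuantumComplexity.ShallowCircuitsRing
import Literature.Computability.Complexity.ConstantDepth
import Literature.Computability.MetaComplexity.SmolenskyProperty
import Literature.Computability.MetaComplexity.RobustHegedusLemma
import HarnessLib
import Summits.QuantumAdvantage.AdviceFreeQNC0.AdviceFreeQNC0
import Summits.QuantumAdvantage.QuantumAdvantage.Theses.RingFrame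
/-!
# RingToElim — skeleton line `product` (BC3 shape) for crux α of route `RingFrame` (qa-qnc0-p1 gen 4, rung F-Q1)

PUBLISHED FORM: Part 1 (the leaf `Summits.QuantumAdvantage.AdviceFreeQNC0.AdviceFreeQNC0`, p409171) and Part 2 (the gate-rendered route file
`Summits.QuantumAdvantage.QuantumAdvantage.Theses.RingFrame`, crux decl `RingToElim`) are IMPORTED; this file is Part 3, published as
`Cruxes/RingToElim/Lines/product.lean` (line card `Lines/product.md`).

Part 3 = the line `product` (cell memo `HOME/qa-qnc0-p1/TARGET.md §17`, `ROUND-4.md`):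
`ElimHard ⟹[LDMA] ProductHardPolylog ⟹ CrossTeamHardPolylog ⟹ RingHardU ⟹ RingHard 2`.
It shares the OUTER stubs `stub_embed`, `stub_transport` and the cross-team vocabulary VERBATIM with p2's line `tensor`
and differs only in how `ElimHard ⟹ CrossTeamHardPolylog` is cut: instead of tensor robustness `TR⁺` of the augmented
elimination codes (line `tensor`), the TRIPLE NORMAL FORM of the product game — every column player is a zero-sum triple
`(g₀,g₁,g₂)` of column-degree-`D` matrices, row `u` loses `|g_{x(u)}(u,·) + F_u| ≥ dist(g_{x(u)}(u,·), 𝓕)` cells, and the three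
potential costs of a row satisfy `c₀ + c₁ + c₂ ≥ w` (`𝓕 = 𝟙 + C_{L'}(D)` is affine) — reduces the crux to ONE weighted
avoidance statement for low-degree maps, `LDMAPolylog` (load-bearing stub): the residue class `wt u ≡ r (3)` carries a
`κ`-fraction of `Σ_u dist(Γ(u), 𝓕_{L'}(D))` for every column-degree-`D` map `Γ`.  The other three stubs are PROVED in prose
(§17.1–17.2 of the memo; p2 ROUND-1 §9.26 for the cross-team dictionary) and M-sized.
-/

open Finset
open Literature.Computability.Cryptography Literature.Computability.Complexity
open Literature.Computability.QuantumComplexity Literature.Computability.MetaComplexity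

set_option linter.dupNamespace false

/-! ## Parts 1–2 — IMPORTED: the leaf (p409171, commit de7c67c6d7f5: `Summit.QuantumAdvantage.AdviceFreeQNC0.RingHard` etc.) and the route file (`…Theses.RingFrame.RingToElim`). -/


/-! ## Part 3 — the line `product` -/
namespace Summit.QuantumAdvantage.QuantumAdvantage.Cruxes.RingToElim.Product

open Literature.Computability.MetaComplexity.Smolensky

noncomputable section

/-! ### shared vocabulary (VERBATIM from line `tensor`, qa-qnc0-p2 `RingToElim_birth_draft_v3.lean`) -/

/-- `GF(2)`-degree `≤ d` of a Boolean function on the cube (tree `Smolensky.lowDeg`). -/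
def HasDeg {N : ℕ} (f : (Fin N → Bool) → Bool) (d : ℕ) : Prop :=
  (fun x => if f x then (1 : ZMod 2) else 0) ∈ lowDeg (ZMod 2) N d

/-- Hamming weight (= tree `Hegedus.wt`). -/
def wt {n : ℕ} (u : Fin n → Bool) : ℕ := (univ.filter fun i : Fin n => u i = true).card

/-- prefix weight `W_g(u) = #{i < g : u_i = 1}`. -/
def wtPrefix {n : ℕ} (u : Fin n → Bool) (g : ℕ) : ℕ := (univ.filter fun i : Fin n => i.val < g ∧ u i = true).card

/-- walk exponent `e_g(u) = W(u) + W_g(u)`. -/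
def walkExp {n : ℕ} (u : Fin n → Bool) (g : ℕ) : ℕ := wt u + wtPrefix u g

/-- WIN of the ring game in walk coordinates (charge `c`). -/
def ringWinU {n : ℕ} (c : ℕ) (y : Fin (n + 1) → (Fin n → Bool) → Bool) (u : Fin n → Bool) : Bool :=
  decide ((univ.filter fun g : Fin (n + 1) => y g u = true ∧ (c + g.val + walkExp u g.val) % 3 ≠ 0).card % 2 = 1)

/-- **RingHardU** — the ring crux in walk coordinates at the trace-form charge `c = n + 2`. -/
def RingHardU : Prop :=
  ∃ θ : ℝ, θ < 1 ∧ ∀ C : ℕ, ∃ n₀ : ℕ, ∀ n ≥ n₀, ∀ y : Fin (n + 1) → (Fin n → Bool) → Bool,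
    (∀ g, HasDeg (y g) ((Nat.log 2 n) ^ C)) →
      ((univ.filter fun u : Fin n → Bool => ringWinU (n + 2) y u = true).card : ℝ) ≤ θ * (2 : ℝ) ^ n

abbrev T4 := Bool × Bool        -- (a, b) ↦ a + b·ω ∈ 𝔽₄

def t4add (p q : T4) : T4 := (xor p.1 q.1, xor p.2 q.2)
/-- multiplication by `ω`: `(a + bω)ω = b + (a + b)ω`. -/
def tMulOmega (p : T4) : T4 := (p.2, xor p.1 p.2)
def tOmegaPow (r : ℕ) (p : T4) : T4 := tMulOmega^[r % 3] p

/-- cross-degree `≤ d`: for every own input, both coordinates are degree-`≤ d` functions of the other block. -/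
def CrossDeg {L L' : ℕ} (d : ℕ) (F : (Fin L → Bool) → (Fin L' → Bool) → T4) : Prop :=
  ∀ u, HasDeg (fun v => (F u v).1) d ∧ HasDeg (fun v => (F u v).2) d

/-- the referee: `X = Λ₀ + ω^{|u|}Λ₁ ∉ {0, ω^{2(c + |u| + |v|)}}`. -/
def crossWin {L L' : ℕ} (c : ℕ) (F₀ : (Fin L → Bool) → (Fin L' → Bool) → T4) (F₁ : (Fin L' → Bool) → (Fin L → Bool) → T4)
    (u : Fin L → Bool) (v : Fin L' → Bool) : Bool :=
  let X := t4add (F₀ u v) (tOmegaPow (wt u) (F₁ v u))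
  decide (X ≠ (false, false) ∧ X ≠ tOmegaPow (2 * (c + wt u + wt v)) (true, false))

def crossWinCount {L L' : ℕ} (c : ℕ) (F₀ : (Fin L → Bool) → (Fin L' → Bool) → T4) (F₁ : (Fin L' → Bool) → (Fin L → Bool) → T4) : ℕ :=
  (univ.filter fun p : (Fin L → Bool) × (Fin L' → Bool) => crossWin c F₀ F₁ p.1 p.2 = true).card

/-- **CrossTeamHardPolylog** (line `tensor`, verbatim). -/
def CrossTeamHardPolylog : Prop :=
  ∃ θ : ℝ, θ < 1 ∧ ∀ C : ℕ, ∃ L₀ : ℕ, ∀ L L' : ℕ, L₀ ≤ L → L₀ ≤ L' →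
    ∀ c : ℕ, ∀ F₀ : (Fin L → Bool) → (Fin L' → Bool) → T4, ∀ F₁ : (Fin L' → Bool) → (Fin L → Bool) → T4,
      CrossDeg ((Nat.log 2 (min L L')) ^ C) F₀ → CrossDeg ((Nat.log 2 (min L L')) ^ C) F₁ →
        (crossWinCount c F₀ F₁ : ℝ) ≤ θ * (2 : ℝ) ^ (L + L')

/-- the elimination-hardness hypothesis `E` of the crux (= the antecedent of `RingFrame.RingToElim`, verbatim). -/
def ElimHard : Prop := ∃ η₀ : ℝ, 0 < η₀ ∧ ∀ C : ℕ, ∃ n₀ : ℕ, ∀ n ≥ n₀, ∀ a b : Literature.Computability.MetaComplexity.Smolensky.CubeFn (ZMod 2) n, a ∈ Literature.Computability.MetaComplexity.Smolensky.lowDeg (ZMod 2) n ((Nat.log 2 n) ^ C) → b ∈ Literature.Computability.MetaComplexity.Smolensky.lowDeg (ZMod 2) n ((Nat.log 2 n) ^ C) → ∀ dec : ZMod 2 → ZMod 2 → ℕ, η₀ * (2 : ℝ) ^ n ≤ ((Finset.univ.filter fun u : Fin n → Bool => dec (a u) (b u) % 3 = Literature.Computability.MetaComplexity.Hegedus.wt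 u % 3).card : ℝ)

/-! ### the product game in STAKES form (cell sketches `QaQnc0.Hadamard` / `QaQnc0.Product`, verbatim) -/

/-- failure bit of the eliminator with stakes `(α, β)` and target class `c` at weight `w`: with `x := (c - w) mod 3`,
stakes `(1,0),(0,1),(1,1)` bet against one class each and `(0,0)` abstains (fails). -/
def elimFailBits (c : ℕ) (α β : Bool) (w : ℕ) : Bool :=
  if (c % 3 + 3 - w % 3) % 3 = 0 then !β else if (c % 3 + 3 - w % 3) % 3 = 1 then !α else (α == β)

/-- failure of the stakes-eliminator `(a, b)` (target class `c`) at `u`. -/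
def elimFail {n : ℕ} (c : ℕ) (a b : (Fin n → Bool) → Bool) (u : Fin n → Bool) : Bool :=
  elimFailBits c (a u) (b u) (wt u)

/-- `h` is the WIN pattern of some stakes-eliminator of degree `≤ D` (any target class) — the elimination code `C_ℓ(D)`. -/
def IsElimWin {ℓ : ℕ} (D : ℕ) (h : (Fin ℓ → Bool) → Bool) : Prop :=
  ∃ c : ℕ, ∃ a b : (Fin ℓ → Bool) → Bool, HasDeg a D ∧ HasDeg b D ∧ ∀ u, h u = !(elimFail c a b u)

/-- `F` is the FAIL pattern of some stakes-eliminator of degree `≤ D` — the affine family `𝓕_ℓ(D) = 𝟙 + C_ℓ(D)`. -/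
def IsElimFail {ℓ : ℕ} (D : ℕ) (F : (Fin ℓ → Bool) → Bool) : Prop :=
  ∃ c : ℕ, ∃ a b : (Fin ℓ → Bool) → Bool, HasDeg a D ∧ HasDeg b D ∧ ∀ v, F v = elimFail c a b v

/-- Hamming distance of two Boolean functions on the cube. -/
def hdist {ℓ : ℕ} (z F : (Fin ℓ → Bool) → Bool) : ℕ := (univ.filter fun v : Fin ℓ → Bool => z v ≠ F v).card

/-- `distFail D z` = Hamming distance from the row `z` to `𝓕_ℓ(D)` (the POTENTIAL COST of showing row `z`). -/
def distFail {ℓ : ℕ} (D : ℕ) (z : (Fin ℓ → Bool) → Bool) : ℕ :=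
  sInf {k : ℕ | ∃ F : (Fin ℓ → Bool) → Bool, IsElimFail D F ∧ hdist z F = k}

/-- agreements of an `L × L'` pair of block patterns (= LOSSES of the product player, = cross-team LOSE cells). -/
def agreeCountR {L L' : ℕ} (X Y : (Fin L → Bool) → (Fin L' → Bool) → Bool) : ℕ :=
  (univ.filter fun p : (Fin L → Bool) × (Fin L' → Bool) => X p.1 p.2 = Y p.1 p.2).card

/-- **ProductHardPolylog** — the `(L, L')` product game at polylog degree: a positive fraction of cells is lost whenever
every column of `X` (a function of `u`) and every row of `Y` (a function of `v`) is the win pattern of a stakes-eliminator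
of degree `≤ (log₂ min(L,L'))^C`. -/
def ProductHardPolylog : Prop :=
  ∃ μ : ℝ, 0 < μ ∧ ∀ C : ℕ, ∃ L₀ : ℕ, ∀ L L' : ℕ, L₀ ≤ L → L₀ ≤ L' →
    ∀ X Y : (Fin L → Bool) → (Fin L' → Bool) → Bool,
      (∀ v, IsElimWin ((Nat.log 2 (min L L')) ^ C) (fun u => X u v)) →
      (∀ u, IsElimWin ((Nat.log 2 (min L L')) ^ C) (fun v => Y u v)) →
        μ * (2 : ℝ) ^ (L + L') ≤ (agreeCountR X Y : ℝ)

/-- **LDMAPolylog — weighted residue non-avoidance for low-degree maps (LOAD-BEARING; cell memo §17.4, rectangular, at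
polylog degree).**  For a map `Γ : {0,1}^L → {0,1}^{{0,1}^{L'}}` all of whose columns `u ↦ Γ u v` have degree `≤ D`, put
`φ(u) := dist(Γ u, 𝓕_{L'}(D))`; then every residue class `wt u ≡ r (3)` carries at least a `κ`-fraction of `Σ_u φ(u)`,
uniformly in `D ≤ (log₂ min(L,L'))^C`.  The SET version (sub-level sets of `u ↦ |Γ u + F|` for one `F`) is FALSE by majority
amplification (§17.8(b)); the weights are essential.  `κ ≤ 3ε(2D)/2` from one Razborov–Smolensky approximator, so `κ` is
not degree-free for `D ≍ √L` but is a constant at polylog degree.  Not in print (qn-lit LIT-MEMO-6/7: no relative /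
weighted robust-Hegedűs statement). -/
def LDMAPolylog : Prop :=
  ∃ κ : ℝ, 0 < κ ∧ ∀ C : ℕ, ∃ L₀ : ℕ, ∀ L L' : ℕ, L₀ ≤ L → L₀ ≤ L' → ∀ D : ℕ, D ≤ (Nat.log 2 (min L L')) ^ C →
    ∀ Γ : (Fin L → Bool) → (Fin L' → Bool) → Bool, (∀ v, HasDeg (fun u => Γ u v) D) → ∀ r : ℕ,
      κ * ((∑ u : Fin L → Bool, distFail D (Γ u) : ℕ) : ℝ) ≤
        ((∑ u ∈ univ.filter (fun u : Fin L → Bool => wt u % 3 = r % 3), distFail D (Γ u) : ℕ) : ℝ)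

/-! ### the stubs -/

/-- **stub_LDMA (load-bearing, L): `LDMAPolylog`.**  Open; the memo's plan: (i) the SEPARABLE case (maps measurable w.r.t. a
degree-`≤ c√L` partition) from proportional avoidance `PLDAMS` via the separable-loss theorem (§17.2, proved); (ii) density
increment / structure-vs-randomness for the general case (§17.5(vii), §17.8(c)–(d)). -/
theorem stub_LDMA : LDMAPolylog := by
  sorry

/-- **stub_product (M): `LDMAPolylog ⟹ ElimHard ⟹ ProductHardPolylog`** — §17.1 + §17.4, PROVED in prose: re-stake all
columns to a common class (class shift = re-staking `(α,β) ↦ (α⊕β, α)`, degree-preserving); Alice is then a zero-sum triple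
`(g₀,g₁,g₂) = (b, a, a⊕b)` of column-degree-`D` matrices and row `u` loses `hdist (g_{x(u)}(u,·)) F_u ≥ distFail D (g_{x(u)}(u,·))`
cells (`F_u` = Bob's fail pattern in row `u`); summing, `#LOSE ≥ Σ_r Σ_{u ∈ L_r} distFail(g_r(u,·)) ≥ κ Σ_u (c₀+c₁+c₂)(u) ≥ κ·2^L·w`
by `LDMAPolylog` (applied to `Γ = g_r`, `r = 0,1,2`) and the potential-cost lemma `c₀+c₁+c₂ ≥ w := distFail D 0` (the three
nearest fail patterns sum to a fail pattern); finally `w ≥ η₀ 2^{L'}` by `ElimHard` at length `L'` (a stakes-eliminator fails at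
least as often as the decoder-eliminator `dec = ` "named class", which `ElimHard` bounds).  `μ = κ η₀`. -/
theorem stub_product : LDMAPolylog → ElimHard → ProductHardPolylog := by
  sorry

/-- **stub_crossToProduct (M): `ProductHardPolylog ⟹ CrossTeamHardPolylog`** — the three-mode XOR law (p2 ROUND-1 §9.26,
PROVED in prose, kernel-checked conventions in p2's cell sketch): for a cross-team profile `(F₀, F₁)` of cross-degree `≤ d` and
any charge, member 0's failure set restricted to a row `u` is the fail pattern of a degree-`d` stakes-eliminator on block `L'`
(class from `c + wt u`), member 1's success set restricted to a column `v` is a win pattern on block `L`, and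
`LOSE = F₀ Δ S₁` = the agreement set of the two win patterns; so `crossWinCount = 2^{L+L'} − agreeCountR X Y` with `X, Y` as in
`ProductHardPolylog`, and `θ = 1 − μ`. -/
theorem stub_crossToProduct : ProductHardPolylog → CrossTeamHardPolylog := by
  sorry

/-- **stub_embed (M, SHARED with line `tensor`).** A walk strategy `y` of degree `≤ (log₂ n)^C` on `n = L + L'` bits (balanced
split) aggregates block by block into a cross-team profile of cross-degree `≤ (log₂ min(L,L'))^{2C}` with the same win set. -/
theorem stub_embed : CrossTeamHardPolylog → RingHardU := by
  sorry

/-- **stub_transport (M, SHARED with line `tensor`).** Trace-form dictionary ring ↔ walk at charge `n + 2`; `θ = (1 + θ')/2`. -/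
theorem stub_transport : RingHardU → Summit.QuantumAdvantage.AdviceFreeQNC0.RingHard 2 := by
  sorry

/-- the composition: the five registered stubs give the route crux BY NAME (no hypotheses; the only `sorry`s are
inside the `stub_*` declarations). -/
theorem RingToElim_of : Summit.QuantumAdvantage.QuantumAdvantage.Theses.RingFrame.RingToElim := by
  intro hE
  exact stub_transport (stub_embed (stub_crossToProduct (stub_product stub_LDMA hE)))

/-- the same composition with the five stub STATEMENTS as hypotheses (sorry-free). -/
theorem ringToElim_of_stubs (hL : LDMAPolylog) (hP : LDMAPolylog → ElimHard → ProductHardPolylog)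
    (hX : ProductHardPolylog → CrossTeamHardPolylog) (h₂ : CrossTeamHardPolylog → RingHardU)
    (h₃ : RingHardU → Summit.QuantumAdvantage.AdviceFreeQNC0.RingHard 2) :
    Summit.QuantumAdvantage.QuantumAdvantage.Theses.RingFrame.RingToElim := by
  intro hE
  exact h₃ (h₂ (hX (hP hL hE)))

/-- sanity: the stakes `(0,0)` abstain (fail on every class), the three non-zero stakes fail on exactly one class each. -/
example : (List.range 3).map (fun w => elimFailBits 0 false false w) = [true, true, true] ∧
    (List.range 3).map (fun w => elimFailBits 0 true false w) = [true, false, false] ∧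
    (List.range 3).map (fun w => elimFailBits 0 false true w) = [false, false, true] ∧
    (List.range 3).map (fun w => elimFailBits 0 true true w) = [false, true, false] := by decide

end

end Summit.QuantumAdvantage.QuantumAdvantage.Cruxes.RingToElim.Product
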